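import Mathlib.Geometry.Manifold.Instances.Icc
import Mathlib.Geometry.Manifold.MFDeriv.SpecificFunctions
import Mathlib.Analysis.SpecialFunctions.Artanh
import Mathlib.Analysis.SpecialFunctions.Log.Deriv
import Mathlib.Analysis.SpecialFunctions.Trigonometric.DerivHyp
import Mathlib.Analysis.InnerProductSpace.Calculus
import Literature.Geometry.Manifold.SmoothEmbeddingInverse
import Literature.Topology.FourManifolds.BoundaryGluingConstruction
import HarnessLib

/-!
# Reparametrising collars by `tanh`: one-variable calculus and two differential lemmas

Support file (everything proved, no definitions, no named facts) for the τ-equivariant collar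
gluing of two umbilic collared metrics (stub `stub_collarGluing` of crux `CorkRegluablePsc`,
item stmt-SmoothPoincare4-3206; Hirsch, *Differential Topology* (1976), Ch. 8 §2; Bär–Hanke
2023, §3).  That gluing reparametrises the closed collars `∂C × [0, 1]`, `∂W × [0, 1]` of the
two pieces by the seam coordinate `t ∈ ℝ`, `s = tanh t` on the side of `C` and `s = tanh (-t)` on
the side of `W`, so that the two warped products `ε² ds² + (1 ∓ 2 μ ε s - C₀ ε² s²) h` become ONE
smooth formula `ε² (1 - tanh² t)² dt² + (1 - 2 μ ε tanh t - C₀ ε² tanh² t) h` on `∂C × ℝ`.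
This file supplies:

* the calculus of `tanh` / `artanh` used by the long open collars (`contDiff_real_tanh`,
  `hasDerivAt_real_tanh`, `contDiffOn_real_artanh`, sign lemmas);
* `hasMFDerivAt_projIcc_comp` — the manifold derivative of `t ↦ projIcc 0 1 (ρ t)` into the
  manifold-with-boundary `[0, 1]` (model `𝓡∂ 1`) at a point with `ρ t₀ ∈ (0, 1)`: in the left
  chart of `[0, 1]` it is `c ↦ c • ρ'(t₀) e₀` (`smulRight_single_apply`);
* `injective_mfderiv_of_isSmoothEmbedding` — a smooth embedding (any models, corners allowed)
  has injective differential (its inverse is smooth on the range,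
  `Literature.Geometry.Manifold.contMDiffOn_invFun_range`);
* `injective_mfderiv_interiorVal` — the inclusion `M - ∂M → M` of the interior has injective
  differential.

## References

* J. M. Lee, *Introduction to Smooth Manifolds*, 2nd ed. (2013), Prop. 4.22. [LeeSmoothManifolds2013]
* M. W. Hirsch, *Differential Topology* (1976), Ch. 8 §2. [Hirsch1976]
-/

noncomputable section


open scoped Manifold ContDiff Topology
open Set Function Filter

namespace Literature.Topology.FourManifolds

/-! ### Calculus of `tanh` and `artanh` -/

/-- `tanh = sinh / cosh` is smooth on `ℝ`. [folklore] -/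
theorem contDiff_real_tanh : ContDiff ℝ ∞ Real.tanh := by
  have h : Real.tanh = fun x ↦ Real.sinh x / Real.cosh x := funext Real.tanh_eq_sinh_div_cosh
  rw [h]
  exact Real.contDiff_sinh.div Real.contDiff_cosh fun x ↦ (Real.cosh_pos x).ne'

/-- `tanh' = 1 - tanh²`. [folklore] -/
theorem hasDerivAt_real_tanh (x : ℝ) : HasDerivAt Real.tanh (1 - Real.tanh x ^ 2) x := by
  have hc : Real.cosh x ≠ 0 := (Real.cosh_pos x).ne'
  have hd : HasDerivAt (fun y ↦ Real.sinh y / Real.cosh y)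
      ((Real.cosh x * Real.cosh x - Real.sinh x * Real.sinh x) / Real.cosh x ^ 2) x :=
    (Real.hasDerivAt_sinh x).div (Real.hasDerivAt_cosh x) hc
  have key : HasDerivAt (fun y ↦ Real.sinh y / Real.cosh y)
      (1 - (Real.sinh x / Real.cosh x) ^ 2) x :=
    hd.congr_deriv (by field_simp)
  have h : Real.tanh = fun y ↦ Real.sinh y / Real.cosh y := funext Real.tanh_eq_sinh_div_cosh
  rw [Real.tanh_eq_sinh_div_cosh, h]
  exact key

/-- `0 < 1 - tanh² x` (since `|tanh x| < 1`). [folklore] -/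
theorem one_sub_tanh_sq_pos (x : ℝ) : 0 < 1 - Real.tanh x ^ 2 :=
  sub_pos.2 ((sq_lt_one_iff_abs_lt_one _).2 (Real.abs_tanh_lt_one x))

/-- `tanh x ∈ (-1, 1)`. [folklore] -/
theorem tanh_mem_Ioo (x : ℝ) : Real.tanh x ∈ Ioo (-1 : ℝ) 1 :=
  ⟨Real.neg_one_lt_tanh x, Real.tanh_lt_one x⟩

/-- `0 ≤ tanh x ↔ 0 ≤ x`. [folklore] -/
theorem tanh_nonneg_iff {x : ℝ} : 0 ≤ Real.tanh x ↔ 0 ≤ x := by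
  rw [Real.tanh_eq_sinh_div_cosh, le_div_iff₀ (Real.cosh_pos x), zero_mul, Real.sinh_nonneg_iff]

/-- `0 < tanh x ↔ 0 < x`. [folklore] -/
theorem tanh_pos_iff {x : ℝ} : 0 < Real.tanh x ↔ 0 < x := by
  rw [Real.tanh_eq_sinh_div_cosh, lt_div_iff₀ (Real.cosh_pos x), zero_mul, Real.sinh_pos_iff]

/-- `tanh x < 0 ↔ x < 0`. [folklore] -/
theorem tanh_neg_iff {x : ℝ} : Real.tanh x < 0 ↔ x < 0 := by
  rw [Real.tanh_eq_sinh_div_cosh, div_lt_iff₀ (Real.cosh_pos x), zero_mul, Real.sinh_neg_iff]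

/-- For `0 ≤ t`, `tanh t ∈ [0, 1]`. [folklore] -/
theorem tanh_mem_Icc {t : ℝ} (ht : 0 ≤ t) : Real.tanh t ∈ Icc (0 : ℝ) 1 :=
  ⟨tanh_nonneg_iff.2 ht, (Real.tanh_lt_one t).le⟩

/-- `artanh = ½ log ((1 + x)/(1 - x))` is smooth on `(-1, 1)`. [folklore] -/
theorem contDiffOn_real_artanh : ContDiffOn ℝ ∞ Real.artanh (Ioo (-1) 1) := by
  have h : EqOn (fun x ↦ 1 / 2 * Real.log ((1 + x) / (1 - x))) Real.artanh (Ioo (-1) 1) :=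
    fun x hx ↦ (Real.artanh_eq_half_log (Ioo_subset_Icc_self hx)).symm
  refine ContDiffOn.congr ?_ fun x hx ↦ (h hx).symm
  refine contDiffOn_const.mul (ContDiffOn.log ?_ ?_)
  · refine (contDiffOn_const.add contDiffOn_id).div (contDiffOn_const.sub contDiffOn_id) ?_
    intro x hx
    simp only [mem_Ioo] at hx
    show (1 : ℝ) - x ≠ 0
    linarith
  · intro x hx
    simp only [mem_Ioo] at hx
    exact (div_pos (by linarith) (by linarith)).ne'

/-! ### The manifold derivative of `t ↦ projIcc 0 1 (ρ t)` in the left chart of `[0, 1]` -/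

/-- The coordinate of `(c ↦ c • ρ' e₀) c` is `c * ρ'`. [folklore] -/
theorem smulRight_single_apply (ρ' c : ℝ) (i : Fin 1) :
    ((1 : ℝ →L[ℝ] ℝ).smulRight (EuclideanSpace.single (0 : Fin 1) ρ')) c i = c * ρ' := by
  have hi : i = 0 := Subsingleton.elim i 0
  subst hi
  simp

/-- **The manifold derivative of `t ↦ projIcc 0 1 (ρ t)` into `[0, 1]`** (model `𝓡∂ 1`) at a
point `t₀` with `ρ t₀ ∈ (0, 1)` and `ρ` differentiable at `t₀`: it is `c ↦ c • ρ'(t₀) e₀`, the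
chart of `[0, 1]` at points `< 1` being the left chart `s ↦ s - 0` (Mathlib's `IccLeftChart`).
[folklore] -/
theorem hasMFDerivAt_projIcc_comp {ρ : ℝ → ℝ} {ρ' t₀ : ℝ} (hρ : HasDerivAt ρ ρ' t₀)
    (h0 : ρ t₀ ∈ Ioo (0 : ℝ) 1) :
    HasMFDerivAt 𝓘(ℝ, ℝ) (𝓡∂ 1) (fun t ↦ Set.projIcc (0 : ℝ) 1 zero_le_one (ρ t)) t₀
      ((1 : ℝ →L[ℝ] ℝ).smulRight (EuclideanSpace.single (0 : Fin 1) ρ')) := by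
  set f : ℝ → Set.Icc (0 : ℝ) 1 := fun t ↦ Set.projIcc (0 : ℝ) 1 zero_le_one (ρ t) with hf
  have hcont : ContinuousAt f t₀ := continuous_projIcc.continuousAt.comp hρ.continuousAt
  have hft₀ : (f t₀ : ℝ) = ρ t₀ := by
    simp only [hf, Set.projIcc_of_mem zero_le_one (Ioo_subset_Icc_self h0)]
  have hlt : (f t₀ : ℝ) < 1 := by rw [hft₀]; exact h0.2
  refine ⟨hcont, ?_⟩
  -- the written expression near `t₀` is `t ↦ (ρ t - 0) e₀`
  have hchart : chartAt (EuclideanHalfSpace 1) (f t₀) = IccLeftChart 0 1 :=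
    Icc_chartedSpaceChartAt_of_le_top hlt
  have hev : ∀ᶠ t in 𝓝 t₀, ρ t ∈ Ioo (0 : ℝ) 1 := hρ.continuousAt.preimage_mem_nhds
    (isOpen_Ioo.mem_nhds h0)
  have hext : extChartAt (𝓡∂ 1) (f t₀) = (IccLeftChart 0 1).extend (𝓡∂ 1) := by
    rw [extChartAt, hchart]
  have hwritten : writtenInExtChartAt 𝓘(ℝ, ℝ) (𝓡∂ 1) t₀ f =ᶠ[𝓝 t₀]
      fun t ↦ (WithLp.toLp 2 fun _ : Fin 1 ↦ ρ t - 0 : EuclideanSpace ℝ (Fin 1)) := by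
    filter_upwards [hev] with t ht
    have hft : f t = ⟨ρ t, Ioo_subset_Icc_self ht⟩ := by
      simp only [hf, Set.projIcc_of_mem zero_le_one (Ioo_subset_Icc_self ht)]
    simp only [writtenInExtChartAt, hext, extChartAt_model_space_eq_id, PartialEquiv.refl_symm,
      PartialEquiv.refl_coe, Function.comp_apply, id_eq]
    rw [hft]
    rfl
  have hpt : (extChartAt 𝓘(ℝ, ℝ) t₀) t₀ = t₀ := by simp
  have key : HasFDerivAt
      (fun t ↦ (WithLp.toLp 2 fun _ : Fin 1 ↦ ρ t - 0 : EuclideanSpace ℝ (Fin 1)))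
      ((1 : ℝ →L[ℝ] ℝ).smulRight (EuclideanSpace.single (0 : Fin 1) ρ')) t₀ := by
    rw [← hasFDerivWithinAt_univ, hasFDerivWithinAt_euclidean]
    intro i
    have h1 : HasFDerivAt (fun t ↦ ρ t - 0) ((1 : ℝ →L[ℝ] ℝ).smulRight ρ') t₀ :=
      (hρ.sub_const 0).hasFDerivAt
    have hL : PiLp.proj 2 (fun _ : Fin 1 ↦ ℝ) i ∘L
        ((1 : ℝ →L[ℝ] ℝ).smulRight (EuclideanSpace.single (0 : Fin 1) ρ')) =
        (1 : ℝ →L[ℝ] ℝ).smulRight ρ' := by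
      refine ContinuousLinearMap.ext_ring ?_
      rw [ContinuousLinearMap.comp_apply, PiLp.proj_apply, smulRight_single_apply,
        ContinuousLinearMap.smulRight_apply, smul_eq_mul]
      simp
    rw [hL]
    exact h1.hasFDerivWithinAt
  rw [hpt, ModelWithCorners.range_eq_univ, hasFDerivWithinAt_univ]
  exact key.congr_of_eventuallyEq hwritten

/-! ### Differentials of smooth embeddings and of the interior inclusion -/

section Embedding

variable {E H E' H' : Type*} [NormedAddCommGroup E] [NormedSpace ℝ E] [TopologicalSpace H]
  [NormedAddCommGroup E'] [NormedSpace ℝ E'] [TopologicalSpace H']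
  {I : ModelWithCorners ℝ E H} {J : ModelWithCorners ℝ E' H'}
  {M : Type*} [TopologicalSpace M] [ChartedSpace H M]
  {N : Type*} [TopologicalSpace N] [ChartedSpace H' N] {n : ℕ∞ω}

/-- **A smooth embedding has injective differential** (any models, corners on either side): the
inverse `f⁻¹` is `C^n` on `range f` (`Literature.Geometry.Manifold.contMDiffOn_invFun_range`,
Lee 2013, Prop. 4.22), and differentiating `f⁻¹ ∘ f = id` within `univ` gives a left inverse of
`df_x`. [cite: LeeSmoothManifolds2013, Prop. 4.22] -/
theorem injective_mfderiv_of_isSmoothEmbedding [Nonempty M] {f : M → N}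
    (hf : Manifold.IsSmoothEmbedding I J n f) (hn : n ≠ 0) (x : M) :
    Injective (mfderiv I J f x) := by
  have hinv : ContMDiffOn J I n (invFun f) (range f) :=
    Literature.Geometry.Manifold.contMDiffOn_invFun_range hf
  have h1 : MDifferentiableWithinAt J I (invFun f) (range f) (f x) :=
    (hinv _ (mem_range_self x)).mdifferentiableWithinAt hn
  have h2 : MDifferentiableAt I J f x := (hf.contMDiff x).mdifferentiableAt hn
  have hcomp : HasMFDerivWithinAt I I (invFun f ∘ f) univ x
      ((mfderivWithin J I (invFun f) (range f) (f x)).comp (mfderiv I J f x)) :=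
    h1.hasMFDerivWithinAt.comp x h2.hasMFDerivAt.hasMFDerivWithinAt fun y _ ↦ mem_range_self y
  have hid : invFun f ∘ f = id :=
    funext fun y ↦ leftInverse_invFun hf.isEmbedding.injective y
  rw [hid, hasMFDerivWithinAt_univ] at hcomp
  have heq := hcomp.mfderiv
  rw [mfderiv_id] at heq
  have key : ∀ v : TangentSpace I x,
      (mfderivWithin J I (invFun f) (range f) (f x)) (mfderiv I J f x v) = v := fun v ↦ by
    have h := DFunLike.congr_fun heq v
    exact h.symm
  intro v w hvw
  rw [← key v, ← key w, hvw]

open Literature.Topology.FourManifolds in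
/-- **The inclusion of the interior `M - ∂M → M` has injective differential**: the map
`ofPt a : M → M - ∂M` (identity on interior points) is smooth near `a` and inverts it.
[folklore] -/
theorem injective_mfderiv_interiorVal [IsManifold I ∞ M] (a : InteriorManifold I M) :
    Injective (mfderiv 𝓘(ℝ, E) I (InteriorManifold.val : InteriorManifold I M → M) a) := by
  have hval : MDifferentiableAt 𝓘(ℝ, E) I (InteriorManifold.val : InteriorManifold I M → M) a :=
    (InteriorManifold.contMDiff_val a).mdifferentiableAt (by simp)
  have hg : ContMDiffAt I 𝓘(ℝ, E) ∞ (InteriorManifold.ofPt a) a.val := by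
    rw [InteriorManifold.contMDiffAt_iff_comp_val]
    have hev : (InteriorManifold.val ∘ InteriorManifold.ofPt a) =ᶠ[𝓝 a.val] id := by
      filter_upwards [InteriorManifold.isOpen_interior_carrier.mem_nhds a.property] with m hm
      exact InteriorManifold.ofPt_val_of_isInteriorPoint a hm
    exact contMDiffAt_id.congr_of_eventuallyEq hev
  have hcomp := mfderiv_comp a (hg.mdifferentiableAt (by simp)) hval
  have hid : InteriorManifold.ofPt a ∘ (InteriorManifold.val : InteriorManifold I M → M) = id :=
    funext fun b ↦ InteriorManifold.val_injective
      (InteriorManifold.ofPt_val_of_isInteriorPoint a b.property)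
  rw [hid, mfderiv_id] at hcomp
  have key : ∀ v : TangentSpace 𝓘(ℝ, E) a,
      (mfderiv I 𝓘(ℝ, E) (InteriorManifold.ofPt a) a.val)
        (mfderiv 𝓘(ℝ, E) I (InteriorManifold.val : InteriorManifold I M → M) a v) = v := fun v ↦
    (DFunLike.congr_fun hcomp v).symm
  intro v w hvw
  rw [← key v, ← key w, hvw]

end Embedding

end Literature.Topology.FourManifolds
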